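import Summits.ABC.IUTFork.Cor312PinnedHonestInflation
import HarnessLib

/-!
# R-H ROUND 2, Q1′ (i) «MINIMUM Σ»: the PER-CELL WEIGHTS of the typed Cor. 3.12 budget, GENERIC part — the pilot-gap weight
# `t(i, v_ℚ) := ((i+1)² − 1)·(−qLocal_{i+1,v_ℚ})`, label arithmetic, the KNAPSACK identity, the total `M = (PN(j²) − 1)·|−|log(q)||`

abc-iut cell, rung LADDER-ABC:A2.RESCUE.H; R-H ROUND 2 seat abc-iut-rh2-w-1 (Q1′ WEIGHTS typer, kernel side; director-abc g3
2026-08-26T22:18:18Z (i), rh-lead g2 22:41:51Z seat map / `plan/rescue/R-H/MIN-SLICE.md` §(i) «TO TYPE (rh2-w-1)», REDUCED per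
abc-iut-rh2-q2-eq 22:50:21Z). PROOF-ONLY file (0 definitions, 0 `Prop` facts) over ANY `Cor312.Setting`; companion
`Repair/RHCellWeightsBed.lean` instantiates at the genuine bed `settingPrVolSharp X`. The «weights» of MIN-SLICE §(i) are SPELLED OUT, never
defined: the weight of the cell `(j, v_ℚ) = (i+1, v_ℚ)` is the summand of abc-iut-rh2-q2-eq's landed majorant
`RH.SigmaStrataEq.offRemainder_le_offPilotGap` (p472500), `t(i, v_ℚ) := ((i+1)² − 1)·(−qLocal_{i+1,v_ℚ})` («trivial-bound cost» `t_triv = c·d` of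
MIN-SLICE §(i): demand `d = j² − 1` q-volumes at the price `c` = the cell's q-volume `|qLocal_{j,v_ℚ}|/l⋇`). NOTHING here re-types that bound
(cited BY NAME); this file supplies the ARITHMETIC the threshold typer (rh2-T-1) and the numerics seats (rh2-tab-1, rh2-tab-2, rh-kit-2) quote:
* §0 LABEL ARITHMETIC: `Σ_{j ≤ n} (j² − 1) = n(n−1)(2n+5)/6` (`sum_range_sqSubOne`, `sum_fin_sqSubOne`), the procession-normalised
  coefficient `PN(j² − 1) = (l⋇−1)(2l⋇+5)/6` (`processionNormalized_sqSubOne`; = abc-iut-w4-d103's `PinnedHonest.inflationCoeff_eq`),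
  the INITIAL-SEGMENT sum `Σ_{j ≤ j₀} (j²−1) = j₀(j₀−1)(2j₀+5)/6` (`sum_fin_sqSubOne_initialSegment`) and the SLICE-FRACTION laws
  `S(j₀)/S(l⋇) ≤ (j₀/l⋇)²·(2j₀+5)/(2l⋇+5) ≤ (j₀/l⋇)²` (`sqSubOneSum_frac_le_cubic`, `sqSubOneSum_frac_le_sq`) — MIN-SLICE §(iv)'s
  «mass of an initial segment ≍ (j₀/l⋇)³» made exact;
* §1 GENERIC over ANY `Cor312.Setting`: `t ≥ 0` where `qLocal ≤ 0`; finite support; the KNAPSACK IDENTITY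
  `mass(W) + mass(Wᶜ) = M` for every window `W ⊆ 𝔽_l^⋇ × V_ℚ` (`mass_add_mass_compl`; so MIN-SLICE §(ii)'s `B_triv(Σᶜ)` IS `M − mass(Σ)`),
  `0 ≤ mass(W) ≤ M`; the TOTAL `M := PN(i ↦ Σᶠ_{v_ℚ} t(i,v_ℚ)) = (PN(j²) − 1)·|−|log(q)|| = ((l⋇−1)(2l⋇+5)/6)·|−|log(q)||` for a
  label-independent q-volume (`totalMass_eq_closedForm`, `totalMass_eq_inflationCoeff_mul`); per place, an initial segment of labels
  `j ≤ j₀` carries `S(j₀)·|q_{v_ℚ}|` of the place's `S(l⋇)·|q_{v_ℚ}|` (`placeSum_initialSegment`, `placeSum_total`);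
* §1b hence abc-iut-w4-d103's rearrangement `PinnedHonest.statement_iff_weightedExcess` reads
  **`Statement ↔ M ≤ PN Σᶠ (hull volume − j²·q-volume)`** (`statement_iff_totalMass_le_excess`): the typed Corollary asks the total hull EXCESS to
  pay the total MASS — a cell `(j, v_ℚ)` ENTERS the volume inequality with demand-side weight `t = (j²−1)·|qLocal_{j,v_ℚ}|/l⋇`, the «`~j²` label
  weighting» of director-abc's Q1′ (i).
HONEST FRAMING: arithmetic identities about OUR typed quantities; nothing here asserts that abc is proved or refuted, or that [IUTchIII]
Cor. 3.12 holds or fails at any datum, or takes a side on any author; typed ≠ proved. [claim: Mochizuki2012, status: disputed] for every IUT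
locution. [cite: Mochizuki2012, IUTchIII Cor. 3.12 p. 173–174, Prop. 3.9 (i)–(iii) p. 116–117, Rmk. 3.9.3 p. 119–120; IUTchIV Thm. 1.10 Step (v)
p. 27–28, p. 23] [cite: DupuyHilado2025, §3.3, Thm. 3.10.1]
-/

noncomputable section

open Set Function

namespace Summit.ABC.IUTFork.Repair.RH.CellWeights

open Summit.ABC.IUTFork.Thm311 Summit.ABC.IUTFork.Cor312 Summit.ABC.IUTFork.Cor312.Setting Summit.ABC.IUTFork.Cor312Vol
  Literature.IUT.LogThetaLattice

/-! ## §0. Label arithmetic: `Σ_{j ≤ n} (j² − 1)`, the procession-normalised coefficient, initial segments, slice fractions -/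

section LabelArithmetic

/-- `Σ_{i<n} ((i+1)² − 1) = n(n−1)(2n+5)/6` (the sum of the label demands `j² − 1`, `j = 1, …, n`). [folklore] -/
theorem sum_range_sqSubOne (n : ℕ) :
    ∑ i ∈ Finset.range n, ((((i : ℕ) : ℝ) + 1) ^ 2 - 1) = (n : ℝ) * (n - 1) * (2 * n + 5) / 6 := by
  induction n with
  | zero => simp
  | succ n ih =>
    rw [Finset.sum_range_succ, ih]
    push_cast
    ring

/-- The same sum over `Fin n` (the label index type of the typed Corollary). [folklore] -/
theorem sum_fin_sqSubOne (n : ℕ) :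
    ∑ i : Fin n, ((((i : ℕ) : ℝ) + 1) ^ 2 - 1) = (n : ℝ) * (n - 1) * (2 * n + 5) / 6 := by
  rw [Fin.sum_univ_eq_sum_range (fun i : ℕ => ((i : ℝ) + 1) ^ 2 - 1) n, sum_range_sqSubOne]

/-- **The procession-normalised demand coefficient** `PN(i ↦ (i+1)² − 1) = (n−1)(2n+5)/6` (`n = l⋇`; [IUTchIII] Prop. 3.9 (i): `PN` is the
plain average over `j ∈ 𝔽_l^⋇`; equals abc-iut-w4-d103's `PinnedHonest.inflationCoeff_eq` `PN(j²) − 1`). [folklore] -/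
theorem processionNormalized_sqSubOne {n : ℕ} (hn : 0 < n) :
    processionNormalized (fun i : Fin n => (((i : ℕ) : ℝ) + 1) ^ 2 - 1) = ((n : ℝ) - 1) * (2 * n + 5) / 6 := by
  unfold processionNormalized
  rw [sum_fin_sqSubOne]
  have : (n : ℝ) ≠ 0 := by exact_mod_cast hn.ne'
  field_simp

/-- **Initial segments**: `Σ_{i<n, i+1 ≤ m} ((i+1)² − 1) = m(m−1)(2m+5)/6` for `m ≤ n` — the demand carried by the labels `j ≤ m = j₀` of a
place whose slice is the initial segment `{1, …, j₀}` (`plan/rescue/R-H/SLICE.md`: every kept row's cells at a place form such a segment).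
[folklore] -/
theorem sum_fin_sqSubOne_initialSegment {m n : ℕ} (hmn : m ≤ n) :
    ∑ i : Fin n, (if (i : ℕ) + 1 ≤ m then (((i : ℕ) : ℝ) + 1) ^ 2 - 1 else 0) =
      (m : ℝ) * (m - 1) * (2 * m + 5) / 6 := by
  rw [Fin.sum_univ_eq_sum_range (fun i : ℕ => if i + 1 ≤ m then ((i : ℝ) + 1) ^ 2 - 1 else 0) n,
    ← Finset.sum_range_add_sum_Ico _ hmn, ← sum_range_sqSubOne m]
  have h2 : ∑ k ∈ Finset.Ico m n, (if k + 1 ≤ m then ((k : ℝ) + 1) ^ 2 - 1 else 0) = 0 :=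
    Finset.sum_eq_zero fun k hk => by
      rw [Finset.mem_Ico] at hk
      rw [if_neg (by omega)]
  rw [h2, add_zero]
  exact Finset.sum_congr rfl fun k hk => by
    rw [Finset.mem_range] at hk
    rw [if_pos (by omega)]

/-- **Slice fraction, cubic law**: for `m ≤ n`, `S(m)·(2n+5)·n² ≤ S(n)·(2m+5)·m²` with `S(k) = k(k−1)(2k+5)/6`, i.e.
`S(m)/S(n) ≤ (m/n)²·(2m+5)/(2n+5)` — an initial segment `j ≤ j₀` of a place carries at most this fraction of the place's demand
(MIN-SLICE §(iv): «≍ (j₀/l⋇)³»). [folklore] -/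
theorem sqSubOneSum_frac_le_cubic {m n : ℕ} (hmn : m ≤ n) :
    (m : ℝ) * (m - 1) * (2 * m + 5) / 6 * ((2 * n + 5) * (n : ℝ) ^ 2) ≤
      (n : ℝ) * (n - 1) * (2 * n + 5) / 6 * ((2 * m + 5) * (m : ℝ) ^ 2) := by
  have hm : (0 : ℝ) ≤ m := Nat.cast_nonneg m
  have hn : (0 : ℝ) ≤ n := Nat.cast_nonneg n
  have hmn' : (m : ℝ) ≤ n := by exact_mod_cast hmn
  have key : (n : ℝ) * (n - 1) * (2 * n + 5) / 6 * ((2 * m + 5) * (m : ℝ) ^ 2) -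
      (m : ℝ) * (m - 1) * (2 * m + 5) / 6 * ((2 * n + 5) * (n : ℝ) ^ 2) =
        (2 * n + 5) * (2 * m + 5) * m * n * (n - m) / 6 := by ring
  have hpos : 0 ≤ (2 * (n : ℝ) + 5) * (2 * m + 5) * m * n * (n - m) / 6 := by
    have : 0 ≤ (n : ℝ) - m := sub_nonneg.mpr hmn'
    positivity
  linarith

/-- **Slice fraction, quadratic law** (cruder): for `m ≤ n`, `S(m)·n² ≤ S(n)·m²`, i.e. `S(m)/S(n) ≤ (m/n)²`. [folklore] -/
theorem sqSubOneSum_frac_le_sq {m n : ℕ} (hmn : m ≤ n) :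
    (m : ℝ) * (m - 1) * (2 * m + 5) / 6 * (n : ℝ) ^ 2 ≤ (n : ℝ) * (n - 1) * (2 * n + 5) / 6 * (m : ℝ) ^ 2 := by
  have hm : (0 : ℝ) ≤ m := Nat.cast_nonneg m
  have hn : (0 : ℝ) ≤ n := Nat.cast_nonneg n
  have hmn' : (m : ℝ) ≤ n := by exact_mod_cast hmn
  have key : (n : ℝ) * (n - 1) * (2 * n + 5) / 6 * (m : ℝ) ^ 2 - (m : ℝ) * (m - 1) * (2 * m + 5) / 6 * (n : ℝ) ^ 2 =
      m * n * (n - m) * (2 * m * n + 5) / 6 := by ring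
  have hpos : 0 ≤ (m : ℝ) * n * (n - m) * (2 * m * n + 5) / 6 := by
    have : 0 ≤ (n : ℝ) - m := sub_nonneg.mpr hmn'
    positivity
  linarith

end LabelArithmetic

/-! ## §1. Generic over any setting: the pilot-gap weight `t(i,v_ℚ) = ((i+1)²−1)·(−qLocal_{i+1,v_ℚ})`, windows (knapsack), the total -/

section Generic

variable {T : ThetaIndex} {S : Situation T} (P : Cor312.Setting S)

/-- **The weight of a cell is non-negative wherever the q-volume is non-positive** (at the genuine bed: always, abc-iut-c312-7
`qLocal_settingPrVolSharp_nonpos`; `(i+1)² ≥ 1`). [folklore] -/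
theorem pilotGapWeight_nonneg {i : Fin T.lstar} {vQ : T.VQ} (hq : P.qLocal (labelSucc i) vQ ≤ 0) :
    0 ≤ ((((i : ℕ) : ℝ) + 1) ^ 2 - 1) * (-P.qLocal (labelSucc i) vQ) :=
  mul_nonneg (by nlinarith [(Nat.cast_nonneg (i : ℕ) : (0 : ℝ) ≤ (i : ℕ))]) (neg_nonneg.mpr hq)

/-- The label-`(i+1)` weights are finitely supported over `v_ℚ` ([IUTchIII] Prop. 3.9 (iii) for the q-pilot: `Setting.qSupport_finite`).
[claim: Mochizuki2012, status: disputed] -/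
theorem support_pilotGapWeight_finite (i : Fin T.lstar) :
    (Function.support fun vQ : T.VQ => ((((i : ℕ) : ℝ) + 1) ^ 2 - 1) * (-P.qLocal (labelSucc i) vQ)).Finite := by
  refine (P.qSupport_finite (labelSucc i)).subset (Function.support_subset_iff'.2 fun vQ hvQ => ?_)
  have h0 : P.qLocal (labelSucc i) vQ = 0 := Function.notMem_support.1 hvQ
  simp only [h0, neg_zero, mul_zero]

/-- The weights restricted to any cell set `A ⊆ 𝔽_l^⋇ × V_ℚ` stay finitely supported over `v_ℚ`, label by label. [folklore] -/
theorem support_indicator_pilotGapWeight_finite (A : Set (Fin T.lstar × T.VQ)) (i : Fin T.lstar) :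
    (Function.support fun vQ : T.VQ =>
      A.indicator (fun c : Fin T.lstar × T.VQ => ((((c.1 : ℕ) : ℝ) + 1) ^ 2 - 1) * (-P.qLocal (labelSucc c.1) c.2)) (i, vQ)).Finite :=
  (support_pilotGapWeight_finite P i).subset (Function.support_subset_iff'.2 fun _ hvQ =>
    Set.indicator_apply_eq_zero.2 fun _ => Function.notMem_support.1 hvQ)

/-- **KNAPSACK IDENTITY.** For EVERY window `W ⊆ 𝔽_l^⋇ × V_ℚ`: `mass(W) + mass(Wᶜ) = M`, where
`mass(A) := PN(i ↦ Σᶠ_{v_ℚ} 1_A(i,v_ℚ)·t(i,v_ℚ))` and `M := PN(i ↦ Σᶠ_{v_ℚ} t(i,v_ℚ))`, `t(i,v_ℚ) = ((i+1)²−1)·(−qLocal_{i+1,v_ℚ})`. Hence the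
trivial-bound budget of the cells OFF a stratum Σ (abc-iut-rh2-q2-eq's off-Σ pilot gap, p472500) is EXACTLY `M − mass(Σ)`: MIN-SLICE §(ii)'s
«`B_triv(Σᶜ) ≤ Tol ⟺ mass(Σ) ≥ M − Tol`». [claim: Mochizuki2012, status: disputed] -/
theorem mass_add_mass_compl (W : Set (Fin T.lstar × T.VQ)) :
    processionNormalized (fun i : Fin T.lstar => ∑ᶠ vQ : T.VQ,
        W.indicator (fun c : Fin T.lstar × T.VQ => ((((c.1 : ℕ) : ℝ) + 1) ^ 2 - 1) * (-P.qLocal (labelSucc c.1) c.2)) (i, vQ)) +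
      processionNormalized (fun i : Fin T.lstar => ∑ᶠ vQ : T.VQ,
        Wᶜ.indicator (fun c : Fin T.lstar × T.VQ => ((((c.1 : ℕ) : ℝ) + 1) ^ 2 - 1) * (-P.qLocal (labelSucc c.1) c.2)) (i, vQ)) =
      processionNormalized (fun i : Fin T.lstar => ∑ᶠ vQ : T.VQ, ((((i : ℕ) : ℝ) + 1) ^ 2 - 1) * (-P.qLocal (labelSucc i) vQ)) := by
  have hlabel : ∀ i : Fin T.lstar,
      (∑ᶠ vQ : T.VQ,
          W.indicator (fun c : Fin T.lstar × T.VQ => ((((c.1 : ℕ) : ℝ) + 1) ^ 2 - 1) * (-P.qLocal (labelSucc c.1) c.2)) (i, vQ)) +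
        ∑ᶠ vQ : T.VQ,
          Wᶜ.indicator (fun c : Fin T.lstar × T.VQ => ((((c.1 : ℕ) : ℝ) + 1) ^ 2 - 1) * (-P.qLocal (labelSucc c.1) c.2)) (i, vQ) =
        ∑ᶠ vQ : T.VQ, ((((i : ℕ) : ℝ) + 1) ^ 2 - 1) * (-P.qLocal (labelSucc i) vQ) := by
    intro i
    rw [← finsum_add_distrib (support_indicator_pilotGapWeight_finite P W i) (support_indicator_pilotGapWeight_finite P Wᶜ i)]
    exact finsum_congr fun vQ =>
      congrFun (Set.indicator_self_add_compl W
        (fun c : Fin T.lstar × T.VQ => ((((c.1 : ℕ) : ℝ) + 1) ^ 2 - 1) * (-P.qLocal (labelSucc c.1) c.2))) (i, vQ)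
  unfold processionNormalized
  rw [← add_div, ← Finset.sum_add_distrib]
  exact congrArg (· / (T.lstar : ℝ)) (Finset.sum_congr rfl fun i _ => hlabel i)

/-- **The mass of a window is non-negative** when the q-volumes at the labels of `𝔽_l^⋇` are `≤ 0`. [folklore] -/
theorem mass_nonneg (W : Set (Fin T.lstar × T.VQ)) (hq : ∀ (i : Fin T.lstar) (vQ : T.VQ), P.qLocal (labelSucc i) vQ ≤ 0) :
    0 ≤ processionNormalized (fun i : Fin T.lstar => ∑ᶠ vQ : T.VQ,
        W.indicator (fun c : Fin T.lstar × T.VQ => ((((c.1 : ℕ) : ℝ) + 1) ^ 2 - 1) * (-P.qLocal (labelSucc c.1) c.2)) (i, vQ)) := by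
  unfold processionNormalized
  exact div_nonneg (Finset.sum_nonneg fun i _ => finsum_nonneg fun vQ =>
    Set.indicator_nonneg (fun c _ => pilotGapWeight_nonneg P (hq c.1 c.2)) _) (Nat.cast_nonneg _)

/-- **… and at most the total** `M` (knapsack identity + non-negativity of the complementary mass). [folklore] -/
theorem mass_le_totalMass (W : Set (Fin T.lstar × T.VQ)) (hq : ∀ (i : Fin T.lstar) (vQ : T.VQ), P.qLocal (labelSucc i) vQ ≤ 0) :
    processionNormalized (fun i : Fin T.lstar => ∑ᶠ vQ : T.VQ,
        W.indicator (fun c : Fin T.lstar × T.VQ => ((((c.1 : ℕ) : ℝ) + 1) ^ 2 - 1) * (-P.qLocal (labelSucc c.1) c.2)) (i, vQ)) ≤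
      processionNormalized (fun i : Fin T.lstar => ∑ᶠ vQ : T.VQ, ((((i : ℕ) : ℝ) + 1) ^ 2 - 1) * (-P.qLocal (labelSucc i) vQ)) := by
  rw [← mass_add_mass_compl P W]
  have h := mass_nonneg P Wᶜ hq
  linarith

/-- With a LABEL-INDEPENDENT q-volume (the q-pilot is ONE object read in every packet; at the genuine bed a theorem, §2) every label's
q-sum is `−|log(q)|` itself (pattern of abc-iut-w4-d103's `PinnedHonest.finsum_qLocal_eq_negLogQ`, restated for a bare `Situation`). [folklore] -/
theorem finsum_qLocal_eq_negLogQ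
    (hindep : ∀ (i i' : Fin T.lstar) (vQ : T.VQ), P.qLocal (labelSucc i) vQ = P.qLocal (labelSucc i') vQ) (i : Fin T.lstar) :
    ∑ᶠ vQ : T.VQ, P.qLocal (labelSucc i) vQ = P.negLogQ := by
  have hl : 0 < T.lstar := lt_of_lt_of_le (by norm_num) T.two_le_lstar
  have hconst : (fun i' : Fin T.lstar => ∑ᶠ vQ : T.VQ, P.qLocal (labelSucc i') vQ) =
      fun _ => ∑ᶠ vQ : T.VQ, P.qLocal (labelSucc i) vQ := by
    funext i'
    exact finsum_congr fun vQ => hindep i' i vQ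
  unfold Setting.negLogQ
  rw [hconst, processionNormalized_const hl]

/-- Label by label, the weights sum to `((i+1)² − 1)·|−|log(q)||` (label-independent q-volume). [claim: Mochizuki2012, status: disputed] -/
theorem finsum_pilotGapWeight_eq
    (hindep : ∀ (i i' : Fin T.lstar) (vQ : T.VQ), P.qLocal (labelSucc i) vQ = P.qLocal (labelSucc i') vQ) (i : Fin T.lstar) :
    ∑ᶠ vQ : T.VQ, ((((i : ℕ) : ℝ) + 1) ^ 2 - 1) * (-P.qLocal (labelSucc i) vQ) = ((((i : ℕ) : ℝ) + 1) ^ 2 - 1) * (-P.negLogQ) := by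
  rw [← mul_finsum, finsum_neg_distrib, finsum_qLocal_eq_negLogQ P hindep i]

/-- **THE TOTAL MASS, closed form**: `M = PN(i ↦ Σᶠ_{v_ℚ} t(i,v_ℚ)) = ((l⋇−1)(2l⋇+5)/6)·|−|log(q)||` for a label-independent q-volume —
the «`~j²` label weighting» summed: `(1/l⋇)·Σ_{j=1}^{l⋇} (j²−1) = (l⋇−1)(2l⋇+5)/6 = l(l+1)/12 − 1` at `l = 2l⋇+1`
(abc-iut-rp-h1 `CandDupuyHilado5.kappa_eq`'s `κ` minus one). [claim: Mochizuki2012, status: disputed] -/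
theorem totalMass_eq_closedForm
    (hindep : ∀ (i i' : Fin T.lstar) (vQ : T.VQ), P.qLocal (labelSucc i) vQ = P.qLocal (labelSucc i') vQ) :
    processionNormalized (fun i : Fin T.lstar => ∑ᶠ vQ : T.VQ, ((((i : ℕ) : ℝ) + 1) ^ 2 - 1) * (-P.qLocal (labelSucc i) vQ)) =
      ((T.lstar : ℝ) - 1) * (2 * T.lstar + 5) / 6 * (-P.negLogQ) := by
  have hl : 0 < T.lstar := lt_of_lt_of_le (by norm_num) T.two_le_lstar
  simp only [finsum_pilotGapWeight_eq P hindep]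
  rw [← processionNormalized_sqSubOne hl]
  unfold processionNormalized
  rw [← Finset.sum_mul, div_mul_eq_mul_div]

/-- **THE TOTAL MASS is abc-iut-w4-d103's inflation coefficient times `|−|log(q)||`**: `M = (PN(j²) − 1)·(−(−|log(q)|))`
(`PinnedHonest.inflationCoeff_eq`). [claim: Mochizuki2012, status: disputed] -/
theorem totalMass_eq_inflationCoeff_mul
    (hindep : ∀ (i i' : Fin T.lstar) (vQ : T.VQ), P.qLocal (labelSucc i) vQ = P.qLocal (labelSucc i') vQ) :
    processionNormalized (fun i : Fin T.lstar => ∑ᶠ vQ : T.VQ, ((((i : ℕ) : ℝ) + 1) ^ 2 - 1) * (-P.qLocal (labelSucc i) vQ)) =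
      (processionNormalized (fun i : Fin T.lstar => (((i : ℕ) + 1 : ℕ) : ℝ) ^ 2) - 1) * (-P.negLogQ) := by
  have hl : 0 < T.lstar := lt_of_lt_of_le (by norm_num) T.two_le_lstar
  rw [totalMass_eq_closedForm P hindep, PinnedHonest.inflationCoeff_eq hl]
  ring

/-- **PER PLACE, the total demand**: at a packet `v_ℚ` with label-independent q-volume `q`, `Σ_{i} t(i,v_ℚ) = S(l⋇)·(−q)`,
`S(n) = n(n−1)(2n+5)/6` (before the `1/l⋇` of `PN`). [folklore] -/
theorem placeSum_total {vQ : T.VQ} {q : ℝ} (hq : ∀ i : Fin T.lstar, P.qLocal (labelSucc i) vQ = q) :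
    ∑ i : Fin T.lstar, ((((i : ℕ) : ℝ) + 1) ^ 2 - 1) * (-P.qLocal (labelSucc i) vQ) =
      (T.lstar : ℝ) * (T.lstar - 1) * (2 * T.lstar + 5) / 6 * (-q) := by
  simp only [hq]
  rw [← Finset.sum_mul, sum_fin_sqSubOne]

/-- **PER PLACE, the mass of an INITIAL SEGMENT of labels**: if the window `W` meets the packet `v_ℚ` exactly in the labels `j = i+1 ≤ j₀`
(`j₀ ≤ l⋇`) and the q-volume at `v_ℚ` is the label-independent `q`, then `Σ_{i} 1_W(i,v_ℚ)·t(i,v_ℚ) = S(j₀)·(−q)`: with `placeSum_total`, the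
place keeps the fraction `S(j₀)/S(l⋇)` of its demand (`sqSubOneSum_frac_le_cubic`: `≤ (j₀/l⋇)²·(2j₀+5)/(2l⋇+5)`). This is MIN-SLICE §(iv)'s
law for the slices of `plan/rescue/R-H/SLICE.md` (every kept row's Σ is such a segment per place). [claim: Mochizuki2012, status: disputed] -/
theorem placeSum_initialSegment {vQ : T.VQ} {q : ℝ} (hq : ∀ i : Fin T.lstar, P.qLocal (labelSucc i) vQ = q) {j₀ : ℕ}
    (hj : j₀ ≤ T.lstar) (W : Set (Fin T.lstar × T.VQ)) (hW : ∀ i : Fin T.lstar, (i, vQ) ∈ W ↔ (i : ℕ) + 1 ≤ j₀) :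
    ∑ i : Fin T.lstar,
        W.indicator (fun c : Fin T.lstar × T.VQ => ((((c.1 : ℕ) : ℝ) + 1) ^ 2 - 1) * (-P.qLocal (labelSucc c.1) c.2)) (i, vQ) =
      (j₀ : ℝ) * (j₀ - 1) * (2 * j₀ + 5) / 6 * (-q) := by
  classical
  have hcell : ∀ i : Fin T.lstar,
      W.indicator (fun c : Fin T.lstar × T.VQ => ((((c.1 : ℕ) : ℝ) + 1) ^ 2 - 1) * (-P.qLocal (labelSucc c.1) c.2)) (i, vQ) =
        (if (i : ℕ) + 1 ≤ j₀ then (((i : ℕ) : ℝ) + 1) ^ 2 - 1 else 0) * (-q) := by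
    intro i
    by_cases h : (i : ℕ) + 1 ≤ j₀
    · rw [Set.indicator_of_mem ((hW i).2 h), if_pos h]
      dsimp only
      rw [hq i]
    · rw [Set.indicator_of_notMem (fun hm => h ((hW i).1 hm)), if_neg h, zero_mul]
  rw [Finset.sum_congr rfl fun i _ => hcell i, ← Finset.sum_mul, sum_fin_sqSubOne_initialSegment hj]

end Generic

/-! ## §1b. The typed Corollary asks the hull EXCESS to pay the MASS (abc-iut-w4-d103's rearrangement, in this file's currency) -/

section Statement

variable {T : ThetaIndex} (S : LatticeSituation T) (P : Cor312.Setting S.toSituation)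

/-- **`Statement ↔ M ≤ PN(i ↦ Σᶠ_{v_ℚ} [logvol ⁿ˒°𝒰_{i+1,v_ℚ} − (i+1)²·qLocal_{i+1,v_ℚ}])`** for EVERY setting with `ThetaFinite` and a
label-independent q-volume: the typed Cor. 3.12 is the inequality «total hull excess over the honest Θ-volume ≥ total mass `M`», the mass
being the `PN`-sum of this file's per-cell weights (abc-iut-w4-d103 `PinnedHonest.statement_iff_weightedExcess` + `totalMass_eq_inflationCoeff_mul`).
So a cell `(j, v_ℚ)` ENTERS the volume inequality with weight `t = (j²−1)·|qLocal_{j,v_ℚ}|/l⋇` on the demand side — the «`~j²` label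
weighting» of director-abc's Q1′ (i). [claim: Mochizuki2012, status: disputed] -/
theorem statement_iff_totalMass_le_excess (hfin : P.ThetaFinite)
    (hindep : ∀ (i i' : Fin T.lstar) (vQ : T.VQ), P.qLocal (labelSucc i) vQ = P.qLocal (labelSucc i') vQ) :
    P.Statement ↔
      processionNormalized (fun i : Fin T.lstar => ∑ᶠ vQ : T.VQ, ((((i : ℕ) : ℝ) + 1) ^ 2 - 1) * (-P.qLocal (labelSucc i) vQ)) ≤
        processionNormalized (fun i : Fin T.lstar =>
          ∑ᶠ vQ : T.VQ, ((S.D P.n).logvol _ vQ (P.thetaHull (labelSucc i) vQ) -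
            (((i : ℕ) + 1 : ℕ) : ℝ) ^ 2 * P.qLocal (labelSucc i) vQ)) := by
  rw [PinnedHonest.statement_iff_weightedExcess S P hfin hindep, totalMass_eq_inflationCoeff_mul P hindep]

end Statement

/-! ## §1c. Datum-level mass of a LABEL-INITIAL-SEGMENT slice and the uniform slice bound (appended 2026-08-27, MIN-SLICE §(iii)/(iv))

For a window `W` whose cells at EVERY packet `v_ℚ` are an initial segment of labels `j = i+1 ≤ j₀(v_ℚ)` — the shape of every kept row's
`Σ_data` (`plan/rescue/R-H/SLICE.md`: all clauses are quadratic in `j`) — and a label-independent q-volume `q(v_ℚ)`: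
`mass(W) = (1/l⋇)·Σᶠ_{v_ℚ} S(j₀(v_ℚ))·(−q(v_ℚ))` against `M = (1/l⋇)·Σᶠ_{v_ℚ} S(l⋇)·(−q(v_ℚ))`, `S(n) = n(n−1)(2n+5)/6`; so the column
«mass(Σ_data)/M» of MIN-SLICE §(iii) is `Σ_v S(j₀(v))·h_v / (S(l⋇)·Σ_v h_v)` (`h_v = −q(v)` the place's q-volume) EXACTLY, and a UNIFORM slice
`j₀ ≤ J` at every place gives `mass(W) ≤ (S(J)/S(l⋇))·M ≤ (J/l⋇)²·(2J+5)/(2l⋇+5)·M` (§0). -/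

section LabelSegment

variable {T : ThetaIndex} {S : Situation T} (P : Cor312.Setting S)

/-- `S(n) = Σ_{j ≤ n} (j² − 1)` is MONOTONE in `n` (each new label adds `(n+1)² − 1 ≥ 0`). [folklore] -/
theorem sqSubOneSum_mono {m n : ℕ} (hmn : m ≤ n) :
    (m : ℝ) * (m - 1) * (2 * m + 5) / 6 ≤ (n : ℝ) * (n - 1) * (2 * n + 5) / 6 := by
  rw [← sum_range_sqSubOne m, ← sum_range_sqSubOne n]
  refine Finset.sum_le_sum_of_subset_of_nonneg (Finset.range_mono hmn) fun i _ _ => ?_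
  nlinarith [(Nat.cast_nonneg i : (0 : ℝ) ≤ (i : ℕ))]

/-- **THE TOTAL MASS AS A SUM OVER PLACES**: with a label-independent q-volume `q(v_ℚ)`,
`M = (Σᶠ_{v_ℚ} S(l⋇)·(−q(v_ℚ)))/l⋇` — every packet carries the full label demand `S(l⋇)` times its q-volume. [claim: Mochizuki2012, status: disputed] -/
theorem totalMass_eq_finsum_placeSum {q : T.VQ → ℝ} (hq : ∀ (i : Fin T.lstar) (vQ : T.VQ), P.qLocal (labelSucc i) vQ = q vQ) :
    processionNormalized (fun i : Fin T.lstar => ∑ᶠ vQ : T.VQ, ((((i : ℕ) : ℝ) + 1) ^ 2 - 1) * (-P.qLocal (labelSucc i) vQ)) =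
      (∑ᶠ vQ : T.VQ, (T.lstar : ℝ) * (T.lstar - 1) * (2 * T.lstar + 5) / 6 * (-q vQ)) / T.lstar := by
  unfold processionNormalized
  rw [sum_finsum_comm Finset.univ (fun (i : Fin T.lstar) (vQ : T.VQ) => ((((i : ℕ) : ℝ) + 1) ^ 2 - 1) * (-P.qLocal (labelSucc i) vQ))
    fun i _ => support_pilotGapWeight_finite P i]
  exact congrArg (· / (T.lstar : ℝ)) (finsum_congr fun vQ => placeSum_total P fun i => hq i vQ)

/-- **THE MASS OF A LABEL-INITIAL-SEGMENT SLICE, datum level.** If the window `W` meets every packet `v_ℚ` exactly in the labels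
`j = i+1 ≤ j₀(v_ℚ)` (`j₀ ≤ l⋇`) and the q-volume is the label-independent `q(v_ℚ)`, then
`mass(W) = (Σᶠ_{v_ℚ} S(j₀(v_ℚ))·(−q(v_ℚ)))/l⋇`, `S(n) = n(n−1)(2n+5)/6` (`placeSum_initialSegment` packet by packet, the label average and the
place sum exchanged by `sum_finsum_comm`). With `totalMass_eq_finsum_placeSum`: MIN-SLICE §(iii)'s ratio «mass(Σ_data)/M» is
`Σ_v S(j₀(v))·h_v / (S(l⋇)·Σ_v h_v)`, `h_v = −q(v) ≥ 0`. [claim: Mochizuki2012, status: disputed] -/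
theorem mass_labelSegment_eq {q : T.VQ → ℝ} (hq : ∀ (i : Fin T.lstar) (vQ : T.VQ), P.qLocal (labelSucc i) vQ = q vQ)
    {j₀ : T.VQ → ℕ} (hj : ∀ vQ : T.VQ, j₀ vQ ≤ T.lstar) (W : Set (Fin T.lstar × T.VQ))
    (hW : ∀ (i : Fin T.lstar) (vQ : T.VQ), (i, vQ) ∈ W ↔ (i : ℕ) + 1 ≤ j₀ vQ) :
    processionNormalized (fun i : Fin T.lstar => ∑ᶠ vQ : T.VQ,
        W.indicator (fun c : Fin T.lstar × T.VQ => ((((c.1 : ℕ) : ℝ) + 1) ^ 2 - 1) * (-P.qLocal (labelSucc c.1) c.2)) (i, vQ)) =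
      (∑ᶠ vQ : T.VQ, (j₀ vQ : ℝ) * (j₀ vQ - 1) * (2 * j₀ vQ + 5) / 6 * (-q vQ)) / T.lstar := by
  unfold processionNormalized
  rw [sum_finsum_comm Finset.univ (fun (i : Fin T.lstar) (vQ : T.VQ) =>
      W.indicator (fun c : Fin T.lstar × T.VQ => ((((c.1 : ℕ) : ℝ) + 1) ^ 2 - 1) * (-P.qLocal (labelSucc c.1) c.2)) (i, vQ))
    fun i _ => support_indicator_pilotGapWeight_finite P W i]
  exact congrArg (· / (T.lstar : ℝ))
    (finsum_congr fun vQ => placeSum_initialSegment P (fun i => hq i vQ) (hj vQ) W fun i => hW i vQ)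

/-- **UNIFORM SLICE BOUND.** If every packet's slice is at most `J ≤ l⋇` labels (`j₀(v_ℚ) ≤ J`) and the q-volumes are `≤ 0` with finite
support, then `mass(W) ≤ (S(J)/l⋇)·Σᶠ_{v_ℚ} (−q(v_ℚ))` while `M = (S(l⋇)/l⋇)·Σᶠ_{v_ℚ} (−q(v_ℚ))` — i.e. `mass(W)/M ≤ S(J)/S(l⋇)`
(`≤ (J/l⋇)²·(2J+5)/(2l⋇+5)`, `sqSubOneSum_frac_le_cubic`): MIN-SLICE §(iv)'s «a slice of `J` labels per place carries `≍ (J/l⋇)³` of the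
mass», exact upper form. [claim: Mochizuki2012, status: disputed] -/
theorem mass_labelSegment_le_uniform {q : T.VQ → ℝ} (hq : ∀ (i : Fin T.lstar) (vQ : T.VQ), P.qLocal (labelSucc i) vQ = q vQ)
    (hq0 : ∀ vQ : T.VQ, q vQ ≤ 0) (hfin : (Function.support q).Finite)
    {j₀ : T.VQ → ℕ} {J : ℕ} (hJ : J ≤ T.lstar) (hj : ∀ vQ : T.VQ, j₀ vQ ≤ J) (W : Set (Fin T.lstar × T.VQ))
    (hW : ∀ (i : Fin T.lstar) (vQ : T.VQ), (i, vQ) ∈ W ↔ (i : ℕ) + 1 ≤ j₀ vQ) :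
    processionNormalized (fun i : Fin T.lstar => ∑ᶠ vQ : T.VQ,
        W.indicator (fun c : Fin T.lstar × T.VQ => ((((c.1 : ℕ) : ℝ) + 1) ^ 2 - 1) * (-P.qLocal (labelSucc c.1) c.2)) (i, vQ)) ≤
      (J : ℝ) * (J - 1) * (2 * J + 5) / 6 * (∑ᶠ vQ : T.VQ, -q vQ) / T.lstar := by
  rw [mass_labelSegment_eq P hq (fun vQ => (hj vQ).trans hJ) W hW, mul_finsum]
  have hsuppS : (Function.support fun vQ : T.VQ => (j₀ vQ : ℝ) * (j₀ vQ - 1) * (2 * j₀ vQ + 5) / 6 * (-q vQ)).Finite :=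
    hfin.subset (Function.support_subset_iff'.2 fun vQ hvQ => by
      rw [Function.notMem_support.1 hvQ, neg_zero, mul_zero])
  have hsuppJ : (Function.support fun vQ : T.VQ => (J : ℝ) * (J - 1) * (2 * J + 5) / 6 * (-q vQ)).Finite :=
    hfin.subset (Function.support_subset_iff'.2 fun vQ hvQ => by
      rw [Function.notMem_support.1 hvQ, neg_zero, mul_zero])
  refine div_le_div_of_nonneg_right ?_ (Nat.cast_nonneg _)
  rw [finsum_eq_sum_of_support_subset _ (s := (hsuppS.union hsuppJ).toFinset) (by simp),
    finsum_eq_sum_of_support_subset _ (s := (hsuppS.union hsuppJ).toFinset) (by simp)]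
  exact Finset.sum_le_sum fun vQ _ =>
    mul_le_mul_of_nonneg_right (sqSubOneSum_mono (hj vQ)) (neg_nonneg.mpr (hq0 vQ))

/-- **… hence `mass(W) ≤ (S(J)/S(l⋇))·M`** in the same situation (`M = (S(l⋇)/l⋇)·Σᶠ(−q)`, `totalMass_eq_finsum_placeSum`), stated
multiplicatively: `S(l⋇)·mass(W) ≤ S(J)·M`. [claim: Mochizuki2012, status: disputed] -/
theorem sqSubOneSum_mul_mass_le_of_uniform {q : T.VQ → ℝ} (hq : ∀ (i : Fin T.lstar) (vQ : T.VQ), P.qLocal (labelSucc i) vQ = q vQ)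
    (hq0 : ∀ vQ : T.VQ, q vQ ≤ 0) (hfin : (Function.support q).Finite)
    {j₀ : T.VQ → ℕ} {J : ℕ} (hJ : J ≤ T.lstar) (hj : ∀ vQ : T.VQ, j₀ vQ ≤ J) (W : Set (Fin T.lstar × T.VQ))
    (hW : ∀ (i : Fin T.lstar) (vQ : T.VQ), (i, vQ) ∈ W ↔ (i : ℕ) + 1 ≤ j₀ vQ) :
    (T.lstar : ℝ) * (T.lstar - 1) * (2 * T.lstar + 5) / 6 *
        processionNormalized (fun i : Fin T.lstar => ∑ᶠ vQ : T.VQ,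
          W.indicator (fun c : Fin T.lstar × T.VQ => ((((c.1 : ℕ) : ℝ) + 1) ^ 2 - 1) * (-P.qLocal (labelSucc c.1) c.2)) (i, vQ)) ≤
      (J : ℝ) * (J - 1) * (2 * J + 5) / 6 *
        processionNormalized (fun i : Fin T.lstar => ∑ᶠ vQ : T.VQ, ((((i : ℕ) : ℝ) + 1) ^ 2 - 1) * (-P.qLocal (labelSucc i) vQ)) := by
  have hmass := mass_labelSegment_le_uniform P hq hq0 hfin hJ hj W hW
  have hSl : (0 : ℝ) ≤ (T.lstar : ℝ) * (T.lstar - 1) * (2 * T.lstar + 5) / 6 := by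
    rw [← sum_range_sqSubOne]
    exact Finset.sum_nonneg fun i _ => by nlinarith [(Nat.cast_nonneg i : (0 : ℝ) ≤ (i : ℕ))]
  rw [totalMass_eq_finsum_placeSum P hq]
  calc (T.lstar : ℝ) * (T.lstar - 1) * (2 * T.lstar + 5) / 6 *
        processionNormalized (fun i : Fin T.lstar => ∑ᶠ vQ : T.VQ,
          W.indicator (fun c : Fin T.lstar × T.VQ => ((((c.1 : ℕ) : ℝ) + 1) ^ 2 - 1) * (-P.qLocal (labelSucc c.1) c.2)) (i, vQ))
      ≤ (T.lstar : ℝ) * (T.lstar - 1) * (2 * T.lstar + 5) / 6 *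
          ((J : ℝ) * (J - 1) * (2 * J + 5) / 6 * (∑ᶠ vQ : T.VQ, -q vQ) / T.lstar) :=
        mul_le_mul_of_nonneg_left hmass hSl
    _ = (J : ℝ) * (J - 1) * (2 * J + 5) / 6 *
          ((∑ᶠ vQ : T.VQ, (T.lstar : ℝ) * (T.lstar - 1) * (2 * T.lstar + 5) / 6 * (-q vQ)) / T.lstar) := by
      rw [← mul_finsum]
      ring

end LabelSegment

end Summit.ABC.IUTFork.Repair.RH.CellWeights

end
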